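import Summits.NavierStokesRegularity.NavierStokesRegularity.Theorems.StrainDoorsLocalNewtonFloating
import Summits.NavierStokesRegularity.NavierStokesRegularity.Theorems.StrainDoorsSmoothingScaling
import HarnessLib

/-!
# StrainDoorsLocalNewtonFloatingClosers — ★★ door D8♮ «FloatingLocalNewtonParityDoor» CLOSED BY NAME

The engine hypothesis `HessSmoothingDilateBound` of `Theorems/StrainDoorsLocalNewtonFloatingDefs` (atom B3 with the scale made
explicit) is the LEAD S-door's theorem `hessSmoothing_dilate_le` (`Theorems/StrainDoorsSmoothingScaling`, p684468) token for token;
hence plate B♮ `FloatingSmoothingBudget` and door D8♮ `FloatingLocalNewtonParityDoor` (D8 with a shell floating above a floor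
`γ₀ > 0`) hold outright, over the kernel-checked compositions of `Theorems/StrainDoorsLocalNewtonFloating`.
`--supports stmt-NavierStokesRegularity-0056 --as helper` (ns-s29-p2 g5; nsreg-p1 g34 GO 2026-08-29T01:00:08Z).

HONEST FRAME: a CONDITIONAL continuation criterion now closed as an implication with all NS-free inputs proved; items 0056
`NoTypeII`, 10661 and NS regularity are NOT proved; nothing here is a route or a summit statement.
-/

noncomputable section

set_option linter.dupNamespace false

namespace Summit.NavierStokesRegularity.NavierStokesRegularity.Theorems.StrainDoors

/-- ★ the engine hypothesis «B3Scaling» holds (LEAD S-door `hessSmoothing_dilate_le`). -/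
theorem hessSmoothingDilateBound_holds : HessSmoothingDilateBound :=
  fun _ _ hr₀ hr₁ => hessSmoothing_dilate_le hr₀ hr₁

/-- ★ PLATE B♮ «FloatingSmoothingBudget» PROVED. -/
theorem floatingSmoothingBudget_holds : FloatingSmoothingBudget :=
  floatingSmoothingBudget_of_dilate hessSmoothingDilateBound_holds

/-- ★★ DOOR D8♮ «FloatingLocalNewtonParityDoor» CLOSED BY NAME. -/
theorem floatingLocalNewtonParityDoor_holds : FloatingLocalNewtonParityDoor :=
  floatingLocalNewtonParityDoor_of_dilate hessSmoothingDilateBound_holds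

end Summit.NavierStokesRegularity.NavierStokesRegularity.Theorems.StrainDoors

end
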